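import Literature.AlgebraicTopology.Homotopy.RelativeLiddedCubes
import Literature.AlgebraicTopology.SingularHomology.JoinCube
import Literature.AlgebraicTopology.SingularHomology.RelativeSimplexClass
import HarnessLib

/-!
# The relative homotopy addition theorem for the cone classes of the faces of a singular simplex

Topic `Literature/AlgebraicTopology/SingularHomology`. E. H. Spanier, *Algebraic Topology* (1966;
Springer 1981), Ch. 7 §5, **Proposition 3** (`Bₙ`, the homotopy addition theorem, p. 395) in the
pushed-forward form of part (d) of the proof of the relative Hurewicz theorem (Thm. 7.5.4, p. 397):
for a singular simplex `σ : (Δⁿ⁺¹, (Δⁿ⁺¹)ⁿ⁻¹, (Δⁿ⁺¹)⁰) → (X, A, x₀)`,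
"`∑ (-1)ⁱ [σ⁽ⁱ⁾]' = η σ_# j_# (bₙ) = 0`" in `π'ₙ(X, A, x₀)`, where
`bₙ = h_{[v₀v₁]}[e⁰ₙ₊₁] + ∑_{0<i≤n+1} (-1)ⁱ [eⁱₙ₊₁]` — the class of the zeroth face, based at
`v₁`, being transported along the edge `[v₀v₁]`.

This file PROVES that identity, for every pair `(X, A)` and `n = M + 3 ≥ 3`, for the singular
simplices `τ : Δ^{M+4} → X` which send the codimension-two skeleton into `A`, the vertices to `a`
**and the whole edge `[v₀, v₁]` to `a`** (so that the transport `h_{[v₀v₁]}` is along a constant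
path; the tree's relative Eilenberg simplices with `1`-skeleton at `a` are such), and for the
following device of relative classes of maps of triples `α : (Δᵐ⁺², ∂Δᵐ⁺², v₀) → (X, A, a)`
(`RelSimplexMap`, `RelativeSimplexClass.lean`):

* **`coneClass α hα ∈ πₘ₊₂(X, A, a)`** — the class of the *cone cell* `α ∘ coneChart : Iᵐ⁺² → X`
  (`JoinCube.lean`: the collapse `κ : Iᵐ⁺² → Δᵐ⁺²` of `CubeSimplexCollapse.lean` with its first
  coordinate reversed, lid `{y₀ = 1} ↦ v₀ ↦ a`, boundary `↦ ∂Δ ↦ A`), a lidded cell, through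
  `LiddedCube.lidClass` (`Homotopy/RelativeLiddedCubes.lean`). It is invariant under homotopies of
  maps of triples (`coneClass_eq_of_homotopy`) and trivial for simplices inside `A`
  (`coneClass_eq_one_of_forall_mem`). (Spanier, p. 391, defines `[α]` through "an arbitrary
  homeomorphism" `(Δⁿ, Δ̇ⁿ) ≈ (Iⁿ, İⁿ)`; a collapse which is a relative homeomorphism serves the
  same purpose, cf. `HomotopyAdditionProofs.lean` for the absolute case. The device
  `relSimplexClass` of `RelativeSimplexClass.lean`, through the radial homeomorphism and a
  J-collapse, is a different representative-level choice, not compared here.)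
* **`sum_neg_one_pow_smul_coneClass_eq_zero`** — **`∑ᵢ (-1)ⁱ [τ ∘ δᵢ] = 0`** in the abelian group
  `π_{M+3}(X, A, a)` (written additively), `[·] = coneClass`.

Proof (no connectivity hypothesis on `A` is needed). Compose `τ` with the *join cube*
`I^{M+4} → Δ^{M+4} = [v₀, v₁] * [v₂, …]` (`joinCube`, `JoinCube.lean`): a lidded cube
(`LiddedCube.IsLidded`: lid `↦ [v₀v₁] ↦ a`, free face and codimension-two strata `↦` skeleton
`↦ A`) whose side faces are the cone cells of the facets `δ₀`, `δ₁`, the *join cells*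
`β ∘ joinCube` of the facets `δᵢ`, `i ≥ 2`, and cells inside `A`. The homotopy addition theorem for
lidded cubes (`LiddedCube.prod_lidClass_cubeFace_zpow_eq_one`, i.e. the cubical homotopy addition
theorem of `CubicalHomotopyAddition.lean` in the path space `P(X; A, a)`, Hatcher, *Algebraic
Topology* (2002), §4.1 pp. 340–341) gives the *mixed* identity
`[τδ₀]_c - [τδ₁]_c - ∑_{i≥2} (-1)ⁱ [τδᵢ]_j = 0` (`sum_mixed_eq_zero`). Applied to the degenerate
simplex `α ∘ s₁` (`degenOne`, merging `v₁` and `v₂`), whose facets `1`, `2` are `α` and whose other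
facets lie in `A`, it yields `[α]_j = -[α]_c` (`ofMul_joinClass_eq_neg`), whence the theorem.

Everything is proved; no named facts.

## References

* E. H. Spanier, *Algebraic Topology*, Springer (1981), Ch. 7 §5, Prop. 3 (p. 395) and part (d) of
  the proof of Thm. 7.5.4 (p. 397); §4 p. 391. [Spanier1981]
* A. Hatcher, *Algebraic Topology*, CUP (2002), §4.1, pp. 340–343. [HatcherAT2002]
-/

noncomputable section

open Set Function
open scoped unitInterval Topology Topology.Homotopy
open Literature.AlgebraicTopology.Homotopy Literature.AlgebraicTopology.Homotopy.LiddedCube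
open Literature.AlgebraicTopology.Homotopy.CubeHAT (cubeFace cubeFace_apply IsExtreme isExtreme_zero
  isExtreme_one)

universe u

namespace Literature.AlgebraicTopology.SingularHomology

open CubeCollapse

variable {X : Type u} [TopologicalSpace X] {A : Set X} {a : A}

/-! ### Cone cells and the cone class -/

section Cone

variable {m : ℕ}

/-- **The cone cell** `α ∘ coneChart : Iᵐ⁺² → X` of a singular simplex `α : Δᵐ⁺² → X`. [folklore] -/
def coneCell (α : C(StdSimplex (m + 2), X)) : C((Fin (m + 2) → I), X) := α.comp (coneChart (m + 1))

/-- The cone cell pointwise. [folklore] -/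
@[simp] lemma coneCell_apply (α : C(StdSimplex (m + 2), X)) (y : Fin (m + 2) → I) :
    coneCell α y = α (coneChart (m + 1) y) := rfl

/-- The cone cell of a map of triples `(Δᵐ⁺², ∂Δᵐ⁺², v₀) → (X, A, a)` is a lidded cell. [folklore] -/
lemma coneCell_mem {α : C(StdSimplex (m + 2), X)} (hα : α ∈ RelSimplexMap (m + 1) A a) :
    coneCell α ∈ LidCell A a m :=
  ⟨fun _ hy => by rw [coneCell_apply, coneChart_apply_of_lid hy]; exact hα.2,
    fun _ hy => hα.1 _ (coneChart_mem_stdBoundary hy)⟩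

/-- **The cone class `[α] ∈ πₘ₊₂(X, A, a)`** of a map of triples `α : (Δᵐ⁺², ∂Δᵐ⁺², v₀) → (X, A, a)`:
the class of its cone cell (Spanier 1981, Ch. 7 §4 p. 391, with the cone collapse for the
"arbitrary homeomorphism"). [cite: Spanier1981, Ch. 7 §4 p. 391] -/
def coneClass (α : C(StdSimplex (m + 2), X)) (hα : α ∈ RelSimplexMap (m + 1) A a) :
    RelHomotopyGroup.Pi (m + 2) X A a :=
  lidClass (coneCell α) (coneCell_mem hα)

/-- Cone classes of pointwise equal maps agree. [folklore] -/
theorem coneClass_congr {α α' : C(StdSimplex (m + 2), X)} (hα : α ∈ RelSimplexMap (m + 1) A a)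
    (hα' : α' ∈ RelSimplexMap (m + 1) A a) (h : ∀ t, α t = α' t) : coneClass α hα = coneClass α' hα' :=
  lidClass_congr _ _ fun _ => h _

/-- **A simplex inside `A` has trivial cone class.** [cite: HatcherAT2002, §4.1 p. 343] -/
theorem coneClass_eq_one_of_forall_mem {α : C(StdSimplex (m + 2), X)} (hα : α ∈ RelSimplexMap (m + 1) A a)
    (h : ∀ t, α t ∈ A) : coneClass α hα = 1 :=
  lidClass_eq_one_of_forall_mem _ fun _ => h _

/-- **Invariance of the cone class under homotopies of maps of triples.** [folklore] -/
theorem coneClass_eq_of_homotopy {α α' : C(StdSimplex (m + 2), X)} (hα : α ∈ RelSimplexMap (m + 1) A a)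
    (hα' : α' ∈ RelSimplexMap (m + 1) A a) (H : C(I × StdSimplex (m + 2), X))
    (h0 : ∀ t, H (0, t) = α t) (h1 : ∀ t, H (1, t) = α' t)
    (hH : ∀ s : I, H.curry s ∈ RelSimplexMap (m + 1) A a) : coneClass α hα = coneClass α' hα' := by
  refine lidClass_eq_of_homotopy _ _ (H.comp (ContinuousMap.prodMap (ContinuousMap.id I) (coneChart (m + 1))))
    (fun _ => h0 _) (fun _ => h1 _) fun s => ?_
  exact coneCell_mem (hH s)

end Cone

/-! ### Join cells -/

section Join

variable {p : ℕ}

variable (a) in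
/-- `β : Δ^{p+3} → X` sends the edge `[v₀, v₁]` (the points whose coordinates beyond the first two
vanish) to `a`. [folklore] -/
def EdgeToBase (β : C(StdSimplex (p + 3), X)) : Prop :=
  ∀ z : StdSimplex (p + 3), (∀ k : Fin (p + 2), (z : Fin (p + 4) → ℝ) k.succ.succ = 0) → β z = a

/-- **The join cell** `β ∘ joinCube : I^{p+3} → X` of a singular simplex `β : Δ^{p+3} → X`. [folklore] -/
def joinCell (β : C(StdSimplex (p + 3), X)) : C((Fin (p + 3) → I), X) := β.comp (joinCube p)

/-- The join cell pointwise. [folklore] -/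
@[simp] lemma joinCell_apply (β : C(StdSimplex (p + 3), X)) (y : Fin (p + 3) → I) :
    joinCell β y = β (joinCube p y) := rfl

/-- The join cell of a simplex with boundary in `A` and edge `[v₀, v₁]` at `a` is a lidded cell.
[folklore] -/
lemma joinCell_mem {β : C(StdSimplex (p + 3), X)} (hβ : ∀ t ∈ stdBoundary (p + 3), β t ∈ A)
    (he : EdgeToBase a β) : joinCell β ∈ LidCell A a (p + 1) :=
  ⟨fun _ hy => he _ fun k => joinCube_apply_succ_succ_of_lid hy k,
    fun _ hy => hβ _ (joinCube_mem_stdBoundary hy)⟩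

/-- **The join class** of a simplex with boundary in `A` and edge `[v₀, v₁]` at `a` (an auxiliary
device, shown below to be the inverse of the cone class). [folklore] -/
def joinClass (β : C(StdSimplex (p + 3), X)) (hβ : ∀ t ∈ stdBoundary (p + 3), β t ∈ A)
    (he : EdgeToBase a β) : RelHomotopyGroup.Pi (p + 3) X A a :=
  lidClass (joinCell β) (joinCell_mem hβ he)

/-- Join classes of pointwise equal maps agree. [folklore] -/
theorem joinClass_congr {β β' : C(StdSimplex (p + 3), X)} (hβ : ∀ t ∈ stdBoundary (p + 3), β t ∈ A)
    (he : EdgeToBase a β) (hβ' : ∀ t ∈ stdBoundary (p + 3), β' t ∈ A) (he' : EdgeToBase a β')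
    (h : ∀ t, β t = β' t) : joinClass β hβ he = joinClass β' hβ' he' :=
  lidClass_congr _ _ fun _ => h _

/-- A simplex inside `A` has trivial join class. [folklore] -/
theorem joinClass_eq_one_of_forall_mem {β : C(StdSimplex (p + 3), X)}
    (hβ : ∀ t ∈ stdBoundary (p + 3), β t ∈ A) (he : EdgeToBase a β) (h : ∀ t, β t ∈ A) :
    joinClass β hβ he = 1 :=
  lidClass_eq_one_of_forall_mem _ fun _ => h _

end Join

/-! ### Faces, vertices and edges of a simplex with codimension-two skeleton in `A` -/

section Facets

variable {M : ℕ} (τ : C(StdSimplex (M + 4), X)) (hA : ∀ t ∈ stdSkel (M + 4) (M + 2), τ t ∈ A)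
  (hv : ∀ i : Fin (M + 5), τ (stdSimplex.vertex (S := ℝ) i) = a) (he : EdgeToBase a τ)

include hA in
/-- The facets send `∂Δ^{M+3}` into `A`. [folklore] -/
lemma facet_boundary (i : Fin (M + 5)) : ∀ t ∈ stdBoundary (M + 3), (τ.comp (stdFace i)) t ∈ A :=
  fun _ ht => hA _ (stdFace_mem_stdSkel i (stdBoundary_subset_stdSkel le_rfl ht))

include hv in
/-- The facets send all vertices to `a`. [folklore] -/
lemma facet_vertex (i : Fin (M + 5)) (l : Fin (M + 4)) :
    (τ.comp (stdFace i)) (stdSimplex.vertex (S := ℝ) l) = a := by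
  rw [ContinuousMap.comp_apply, stdFace_vertex, hv]

/-- Inserting a zero at a position `≥ 2` keeps the coordinates beyond the first two at zero.
[folklore] -/
lemma insertNth_succ_succ_succ_succ_eq_zero {n : ℕ} (J : Fin (n + 3)) (z : Fin (n + 4) → ℝ)
    (hz : ∀ k : Fin (n + 2), z k.succ.succ = 0) (k : Fin (n + 3)) :
    Fin.insertNth (α := fun _ => ℝ) J.succ.succ 0 z k.succ.succ = 0 := by
  by_cases hk : k.succ.succ = J.succ.succ
  · rw [hk, Fin.insertNth_apply_same]
  · obtain ⟨l, hl⟩ := Fin.exists_succAbove_eq hk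
    rw [← hl, Fin.insertNth_apply_succAbove]
    -- `l ≥ 2` since `succAbove` of `0`, `1` stays below `2`
    have hl2 : 2 ≤ (l : ℕ) := by
      by_contra h
      have hlt : l.castSucc < J.succ.succ := by
        rw [Fin.lt_def, Fin.val_castSucc]; simp; omega
      have := congrArg Fin.val hl
      rw [Fin.succAbove_of_castSucc_lt _ _ hlt, Fin.val_castSucc] at this
      simp at this; omega
    obtain ⟨l', rfl⟩ : ∃ l' : Fin (n + 2), l = l'.succ.succ :=
      ⟨(l.pred (by intro h; simp [h] at hl2)).pred (by
          intro h; have := congrArg Fin.val h; simp at this; omega), by simp⟩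
    exact hz l'

include he in
/-- The facets `δᵢ`, `i ≥ 2`, send the edge `[v₀, v₁]` to `a`. [folklore] -/
lemma facet_edge (J : Fin (M + 3)) : EdgeToBase a (τ.comp (stdFace J.succ.succ)) := by
  intro z hz
  rw [ContinuousMap.comp_apply]
  refine he _ fun k => ?_
  rw [coe_stdFace]
  exact insertNth_succ_succ_succ_succ_eq_zero J _ hz k

end Facets

/-! ### The lidded cube of a singular simplex and the mixed identity -/

section Cube

variable {M : ℕ} (τ : C(StdSimplex (M + 4), X)) (hA : ∀ t ∈ stdSkel (M + 4) (M + 2), τ t ∈ A)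
  (hv : ∀ i : Fin (M + 5), τ (stdSimplex.vertex (S := ℝ) i) = a) (he : EdgeToBase a τ)

/-- **The cube of a singular simplex**: `τ ∘ joinCube : I^{M+4} → X`. [folklore] -/
def simplexCube : C((Fin (M + 4) → I), X) := τ.comp (joinCube (M + 1))

/-- The cube of a singular simplex pointwise. [folklore] -/
@[simp] lemma simplexCube_apply (y : Fin (M + 4) → I) : simplexCube τ y = τ (joinCube (M + 1) y) := rfl

include hA he in
/-- **The cube of a simplex with codimension-two skeleton in `A` and edge at `a` is lidded.**
[folklore] -/
lemma isLidded_simplexCube : IsLidded A a (simplexCube τ) where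
  lid _ hy := he _ fun k => joinCube_apply_succ_succ_of_lid hy k
  free _ hy := hA _ (joinCube_mem_stdSkel_of_free hy)
  skel _ _ _ hij hi hj := hA _ (joinCube_mem_stdSkel_of_two hij hi hj)

include hA he in
/-- The face `{e = 1}` of the cube is the cone class of the facet `δ₀`. [folklore] -/
lemma lidClass_cubeFace_one_one (hmem : τ.comp (stdFace 0) ∈ RelSimplexMap (M + 2) A a) :
    lidClass (cubeFace (simplexCube τ) (Fin.succ 0) 1)
        ((isLidded_simplexCube τ hA he).cubeFace_succ_mem 0 isExtreme_one) =
      coneClass (τ.comp (stdFace 0)) hmem :=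
  lidClass_congr _ _ fun y => by
    rw [cubeFace_apply, simplexCube_apply, Fin.succ_zero_eq_one, joinCube_insertNth_one y isExtreme_one,
      if_pos rfl]
    rfl

include hA he in
/-- The face `{e = 0}` of the cube is the cone class of the facet `δ₁`. [folklore] -/
lemma lidClass_cubeFace_one_zero (hmem : τ.comp (stdFace 1) ∈ RelSimplexMap (M + 2) A a) :
    lidClass (cubeFace (simplexCube τ) (Fin.succ 0) 0)
        ((isLidded_simplexCube τ hA he).cubeFace_succ_mem 0 isExtreme_zero) =
      coneClass (τ.comp (stdFace 1)) hmem :=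
  lidClass_congr _ _ fun y => by
    rw [cubeFace_apply, simplexCube_apply, Fin.succ_zero_eq_one, joinCube_insertNth_one y isExtreme_zero,
      if_neg zero_ne_one]
    rfl

include hA he in
/-- The faces `{t_k = 1}` of the cube are the join classes of the facets `δ_{k+2}`. [folklore] -/
lemma lidClass_cubeFace_succ_succ_one (k : Fin (M + 2))
    (hb : ∀ t ∈ stdBoundary (M + 3), (τ.comp (stdFace k.castSucc.succ.succ)) t ∈ A)
    (hed : EdgeToBase a (τ.comp (stdFace k.castSucc.succ.succ))) :
    lidClass (cubeFace (simplexCube τ) k.succ.succ 1)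
        ((isLidded_simplexCube τ hA he).cubeFace_succ_mem k.succ isExtreme_one) =
      joinClass (τ.comp (stdFace k.castSucc.succ.succ)) hb hed :=
  lidClass_congr _ _ fun y => by
    rw [cubeFace_apply, simplexCube_apply, joinCube_succ_insertNth_succ_succ_one]; rfl

include hA he in
/-- The face `{t_{M+1} = 0}` of the cube is the join class of the last facet. [folklore] -/
lemma lidClass_cubeFace_last_zero
    (hb : ∀ t ∈ stdBoundary (M + 3), (τ.comp (stdFace (Fin.last (M + 2)).succ.succ)) t ∈ A)
    (hed : EdgeToBase a (τ.comp (stdFace (Fin.last (M + 2)).succ.succ))) :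
    lidClass (cubeFace (simplexCube τ) (Fin.last (M + 1)).succ.succ 0)
        ((isLidded_simplexCube τ hA he).cubeFace_succ_mem (Fin.last (M + 1)).succ isExtreme_zero) =
      joinClass (τ.comp (stdFace (Fin.last (M + 2)).succ.succ)) hb hed :=
  lidClass_congr _ _ fun y => by
    rw [cubeFace_apply, simplexCube_apply, show (Fin.last (M + 1)).succ.succ = Fin.last (M + 3) from
      by simp [Fin.succ_last], joinCube_succ_insertNth_last_zero,
      show Fin.last (M + 4) = (Fin.last (M + 2)).succ.succ from by simp [Fin.succ_last]]
    rfl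

include hA he in
/-- The faces `{t_k = 0}`, `k ≤ M`, of the cube lie in `A` and have trivial class. [folklore] -/
lemma lidClass_cubeFace_succ_succ_zero (k : Fin (M + 2)) (hk : (k : ℕ) < M + 1) :
    lidClass (cubeFace (simplexCube τ) k.succ.succ 0)
        ((isLidded_simplexCube τ hA he).cubeFace_succ_mem k.succ isExtreme_zero) = 1 :=
  lidClass_eq_one_of_forall_mem _ fun y => by
    rw [cubeFace_apply, simplexCube_apply]
    exact hA _ (joinCube_insertNth_succ_succ_zero_mem_stdSkel k hk y)

/-- The alternating-sum bookkeeping behind the mixed identity: the sum over the facets, written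
with the cone terms first and the join terms negated, against the sum over the pairs of side faces
of the cube. [folklore] -/
lemma sum_cons_cons_neg_eq {V : Type*} [AddCommGroup V] {M : ℕ} (c₀ c₁ : V) (j : Fin (M + 3) → V) :
    ∑ i : Fin (M + 5), ((-1 : ℤ) ^ (i : ℕ)) • (Fin.cons c₀ (Fin.cons c₁ fun k => -j k) : Fin (M + 5) → V) i =
      (c₀ - c₁) + ∑ k : Fin (M + 2), ((-1 : ℤ) ^ ((k : ℕ) + 1)) •
        (j k.castSucc - if k = Fin.last (M + 1) then j (Fin.last (M + 2)) else 0) := by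
  rw [Fin.sum_univ_succ, Fin.sum_univ_succ, Fin.sum_univ_castSucc]
  simp only [Fin.cons_zero, Fin.cons_succ, Fin.val_zero, pow_zero, one_smul, Fin.val_succ, zero_add,
    pow_one, Fin.val_castSucc, Fin.val_last, smul_sub, smul_neg, smul_ite, smul_zero,
    Finset.sum_sub_distrib, Finset.sum_ite_eq', Finset.mem_univ, if_true, neg_smul, one_smul,
    Finset.sum_neg_distrib]
  simp only [pow_succ, mul_neg_one, neg_neg, neg_smul, Finset.sum_neg_distrib]
  abel

include hA hv he in
/-- **The mixed identity** (the homotopy addition theorem for the lidded cube of `τ`, with its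
faces identified): `∑ᵢ (-1)ⁱ Dᵢ = 0` in `π_{M+3}(X, A, a)` where `D₀ = [τδ₀]_c`, `D₁ = [τδ₁]_c` are
cone classes and `D_{k+2} = -[τδ_{k+2}]_j` are negated join classes. [folklore] -/
theorem sum_mixed_eq_zero :
    ∑ i : Fin (M + 5), ((-1 : ℤ) ^ (i : ℕ)) •
      (Fin.cons (Additive.ofMul (coneClass (τ.comp (stdFace 0)) (comp_stdFace_mem_relSimplexMap τ hA hv 0)))
        (Fin.cons (Additive.ofMul (coneClass (τ.comp (stdFace 1)) (comp_stdFace_mem_relSimplexMap τ hA hv 1)))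
          fun k : Fin (M + 3) => -Additive.ofMul (joinClass (τ.comp (stdFace k.succ.succ))
            (facet_boundary τ hA _) (facet_edge τ he k))) :
        Fin (M + 5) → Additive (RelHomotopyGroup.Pi (M + 3) X A a)) i = 0 := by
  rw [sum_cons_cons_neg_eq]
  have key := congrArg Additive.ofMul (isLidded_simplexCube τ hA he).prod_lidClass_cubeFace_zpow_eq_one
  rw [ofMul_one, ofMul_prod] at key
  simp only [ofMul_zpow, ofMul_mul, ofMul_inv, ← sub_eq_add_neg] at key
  rw [Fin.sum_univ_succ, Fin.val_zero, pow_zero, one_smul,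
    lidClass_cubeFace_one_one τ hA he (comp_stdFace_mem_relSimplexMap τ hA hv 0),
    lidClass_cubeFace_one_zero τ hA he (comp_stdFace_mem_relSimplexMap τ hA hv 1)] at key
  refine Eq.trans ?_ key
  rw [add_right_inj]
  refine Finset.sum_congr rfl fun k _ => ?_
  rw [Fin.val_succ, lidClass_cubeFace_succ_succ_one τ hA he k (facet_boundary τ hA _) (facet_edge τ he k.castSucc)]
  by_cases hk : k = Fin.last (M + 1)
  · subst hk
    rw [if_pos rfl, lidClass_cubeFace_last_zero τ hA he (facet_boundary τ hA _) (facet_edge τ he (Fin.last (M + 2)))]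
  · rw [if_neg hk, lidClass_cubeFace_succ_succ_zero τ hA he k (Fin.val_lt_last hk), ofMul_one]

end Cube

/-! ### The degeneracy merging `v₁` and `v₂`; join classes are inverse cone classes -/

section Degenerate

variable {n : ℕ}

/-- The coordinates of the degeneracy `s₁ : Δⁿ⁺² → Δⁿ⁺¹` merging the vertices `v₁`, `v₂`:
`(z₀, z₁ + z₂, z₃, …)`. [folklore] -/
def degenCoord (z : StdSimplex (n + 2)) : Fin (n + 2) → ℝ :=
  Fin.cons ((z : Fin (n + 3) → ℝ) 0) (Fin.cons ((z : Fin (n + 3) → ℝ) 1 + (z : Fin (n + 3) → ℝ) 2)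
    fun l => (z : Fin (n + 3) → ℝ) l.succ.succ.succ)

/-- `degenCoord z 0 = z₀`. [folklore] -/
@[simp] lemma degenCoord_zero (z : StdSimplex (n + 2)) : degenCoord z 0 = (z : Fin (n + 3) → ℝ) 0 := rfl

/-- `degenCoord z 1 = z₁ + z₂`. [folklore] -/
@[simp] lemma degenCoord_one (z : StdSimplex (n + 2)) :
    degenCoord z 1 = (z : Fin (n + 3) → ℝ) 1 + (z : Fin (n + 3) → ℝ) 2 := rfl

/-- `degenCoord z (l + 2) = z_{l+3}`. [folklore] -/
@[simp] lemma degenCoord_succ_succ (z : StdSimplex (n + 2)) (l : Fin n) :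
    degenCoord z l.succ.succ = (z : Fin (n + 3) → ℝ) l.succ.succ.succ := rfl

/-- **The degeneracy `s₁ : Δⁿ⁺² → Δⁿ⁺¹`** merging the vertices `v₁` and `v₂` (Mathlib's
`stdSimplex.map (Fin.predAbove 1)`, written out in coordinates). [folklore] -/
def degenOne (n : ℕ) : C(StdSimplex (n + 2), StdSimplex (n + 1)) where
  toFun z := ⟨degenCoord z, fun i => by
      cases i using Fin.cases with
      | zero => exact z.2.1 0
      | succ j =>
        cases j using Fin.cases with
        | zero => exact add_nonneg (z.2.1 1) (z.2.1 2)
        | succ l => exact z.2.1 _, by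
      have hs : ∑ i, (z : Fin (n + 3) → ℝ) i = 1 := z.2.2
      rw [Fin.sum_univ_succ, Fin.sum_univ_succ, Fin.sum_univ_succ] at hs
      simp only [Fin.succ_zero_eq_one, Fin.succ_one_eq_two] at hs
      rw [Fin.sum_univ_succ, Fin.sum_univ_succ]
      simp only [degenCoord_zero, degenCoord_succ_succ]
      change _ + (((z : Fin (n + 3) → ℝ) 1 + (z : Fin (n + 3) → ℝ) 2) + _) = 1
      linarith⟩
  continuous_toFun := by
    have hc : ∀ i : Fin (n + 3), Continuous fun z : StdSimplex (n + 2) => (z : Fin (n + 3) → ℝ) i :=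
      fun i => (continuous_apply i).comp continuous_subtype_val
    refine Continuous.subtype_mk (continuous_pi fun i => ?_) _
    cases i using Fin.cases with
    | zero => simp only [degenCoord_zero]; exact hc 0
    | succ j =>
      cases j using Fin.cases with
      | zero => simp only [degenCoord, Fin.cons_succ, Fin.cons_zero]; exact (hc 1).add (hc 2)
      | succ l => simp only [degenCoord_succ_succ]; exact hc _

/-- The coordinates of the degeneracy. [folklore] -/
@[simp] lemma coe_degenOne (z : StdSimplex (n + 2)) :
    ((degenOne n z : StdSimplex (n + 1)) : Fin (n + 2) → ℝ) = degenCoord z := rfl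

/-- `insertNth 1 x p 0 = p 0`. [folklore] -/
lemma insertNth_one_apply_zero {β : Type*} {k : ℕ} (x : β) (p : Fin (k + 1) → β) :
    Fin.insertNth (α := fun _ => β) 1 x p 0 = p 0 := by
  rw [← Fin.succAbove_ne_zero_zero (one_ne_zero (α := Fin (k + 2))), Fin.insertNth_apply_succAbove]

/-- `insertNth 1 x p (j + 2) = p (j + 1)`. [folklore] -/
lemma insertNth_one_apply_succ_succ {β : Type*} {k : ℕ} (x : β) (p : Fin (k + 1) → β) (j : Fin k) :
    Fin.insertNth (α := fun _ => β) 1 x p j.succ.succ = p j.succ := by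
  rw [show j.succ.succ = (1 : Fin (k + 2)).succAbove j.succ from by
    rw [← Fin.succ_zero_eq_one, Fin.succ_succAbove_succ, Fin.succAbove_zero], Fin.insertNth_apply_succAbove]

/-- `insertNth 1 x p 2 = p 1`. [folklore] -/
lemma insertNth_one_apply_two {β : Type*} {k : ℕ} (x : β) (p : Fin (k + 2) → β) :
    Fin.insertNth (α := fun _ => β) 1 x p 2 = p 1 := by
  rw [show (2 : Fin (k + 3)) = (1 : Fin (k + 3)).succAbove 1 from by
    rw [Fin.succAbove_of_le_castSucc _ _ (by rw [Fin.le_def, Fin.val_castSucc, Fin.val_one, Fin.val_one]),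
      Fin.succ_one_eq_two], Fin.insertNth_apply_succAbove]

/-- `insertNth 2 x p 0 = p 0`. [folklore] -/
lemma insertNth_two_apply_zero {β : Type*} {k : ℕ} (x : β) (p : Fin (k + 2) → β) :
    Fin.insertNth (α := fun _ => β) 2 x p 0 = p 0 := by
  rw [← Fin.succAbove_ne_zero_zero (show (2 : Fin (k + 3)) ≠ 0 from by
      rw [Ne, Fin.ext_iff, Fin.val_two, Fin.val_zero]; omega),
    Fin.insertNth_apply_succAbove]

/-- `insertNth 2 x p 1 = p 1`. [folklore] -/
lemma insertNth_two_apply_one {β : Type*} {k : ℕ} (x : β) (p : Fin (k + 2) → β) :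
    Fin.insertNth (α := fun _ => β) 2 x p 1 = p 1 := by
  rw [show (1 : Fin (k + 3)) = (2 : Fin (k + 3)).succAbove 1 from by
    rw [Fin.succAbove_of_castSucc_lt _ _ (by
      rw [Fin.lt_def, Fin.val_castSucc, Fin.val_one, Fin.val_two]; omega), Fin.castSucc_one],
    Fin.insertNth_apply_succAbove]

/-- `insertNth 2 x p (j + 3) = p (j + 2)`. [folklore] -/
lemma insertNth_two_apply_succ_succ_succ {β : Type*} {k : ℕ} (x : β) (p : Fin (k + 2) → β) (j : Fin k) :
    Fin.insertNth (α := fun _ => β) 2 x p j.succ.succ.succ = p j.succ.succ := by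
  rw [show j.succ.succ.succ = (2 : Fin (k + 3)).succAbove j.succ.succ from by
    rw [← Fin.succ_one_eq_two, Fin.succ_succAbove_succ, ← Fin.succ_zero_eq_one, Fin.succ_succAbove_succ,
      Fin.succAbove_zero], Fin.insertNth_apply_succAbove]

/-- A coordinate function of `Δⁿ⁺¹` in block form `(w₀, w₁, w₂, …)`. [folklore] -/
lemma eq_cons_cons {n : ℕ} (w : Fin (n + 2) → ℝ) :
    w = Fin.cons (w 0) (Fin.cons (w 1) fun l => w l.succ.succ) := by
  funext i
  cases i using Fin.cases with
  | zero => rfl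
  | succ j =>
    cases j using Fin.cases with
    | zero => rfl
    | succ l => rfl

/-- `s₁ ∘ δ₁ = id`. [folklore] -/
lemma degenOne_stdFace_one (w : StdSimplex (n + 1)) : degenOne n (stdFace 1 w) = w := by
  apply StdSimplex.ext_coe
  rw [coe_degenOne]
  conv_rhs => rw [eq_cons_cons (w : Fin (n + 2) → ℝ)]
  funext i
  cases i using Fin.cases with
  | zero => rw [degenCoord_zero, coe_stdFace, insertNth_one_apply_zero]; rfl
  | succ j =>
    cases j using Fin.cases with
    | zero =>
      rw [Fin.cons_succ, Fin.cons_zero, Fin.succ_zero_eq_one, degenCoord_one, coe_stdFace,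
        Fin.insertNth_apply_same, insertNth_one_apply_two, zero_add]
    | succ l =>
      rw [degenCoord_succ_succ, coe_stdFace, insertNth_one_apply_succ_succ]; rfl

/-- `s₁ ∘ δ₂ = id`. [folklore] -/
lemma degenOne_stdFace_two (w : StdSimplex (n + 1)) : degenOne n (stdFace 2 w) = w := by
  apply StdSimplex.ext_coe
  rw [coe_degenOne]
  conv_rhs => rw [eq_cons_cons (w : Fin (n + 2) → ℝ)]
  funext i
  cases i using Fin.cases with
  | zero => rw [degenCoord_zero, coe_stdFace, insertNth_two_apply_zero]; rfl
  | succ j =>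
    cases j using Fin.cases with
    | zero =>
      rw [Fin.cons_succ, Fin.cons_zero, Fin.succ_zero_eq_one, degenCoord_one, coe_stdFace,
        insertNth_two_apply_one, Fin.insertNth_apply_same, add_zero]
    | succ l =>
      rw [degenCoord_succ_succ, coe_stdFace, insertNth_two_apply_succ_succ_succ]; rfl

/-- `s₁ ∘ δ₀` lands in the facet `{z₀ = 0}`. [folklore] -/
lemma degenOne_stdFace_zero_apply_zero (w : StdSimplex (n + 1)) :
    ((degenOne n (stdFace 0 w) : StdSimplex (n + 1)) : Fin (n + 2) → ℝ) 0 = 0 := by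
  rw [coe_degenOne, degenCoord_zero, stdFace_apply_self]

/-- `s₁ ∘ δ_{l+3}` lands in the facet `{z_{l+2} = 0}`. [folklore] -/
lemma degenOne_stdFace_succ_succ_succ_apply (l : Fin n) (w : StdSimplex (n + 1)) :
    ((degenOne n (stdFace l.succ.succ.succ w) : StdSimplex (n + 1)) : Fin (n + 2) → ℝ) l.succ.succ = 0 := by
  rw [coe_degenOne, degenCoord_succ_succ, stdFace_apply_self]

/-- The degeneracy maps the codimension-two skeleton into the boundary. [folklore] -/
lemma degenOne_mem_stdBoundary {z : StdSimplex (n + 2)} (hz : z ∈ stdSkel (n + 2) n) :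
    degenOne n z ∈ stdBoundary (n + 1) := by
  -- two vanishing coordinates of `z`
  rw [mem_stdSkel_iff] at hz
  have hcompl : 2 ≤ ((StdSimplex.nzCoords z)ᶜ).card := by
    rw [Finset.card_compl, Fintype.card_fin]; omega
  obtain ⟨i, hi, j, hj, hij⟩ := Finset.one_lt_card.1 hcompl
  rw [Finset.mem_compl, StdSimplex.mem_nzCoords, not_not] at hi hj
  -- a vanishing coordinate off `{1, 2}` survives; otherwise `z₁ = z₂ = 0`
  have key : ∀ i : Fin (n + 3), (z : Fin (n + 3) → ℝ) i = 0 → i ≠ 1 → i ≠ 2 →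
      degenOne n z ∈ stdBoundary (n + 1) := by
    intro i hi h1 h2
    cases i using Fin.cases with
    | zero => exact ⟨0, by rw [coe_degenOne, degenCoord_zero, hi]⟩
    | succ j =>
      cases j using Fin.cases with
      | zero => exact absurd rfl h1
      | succ l =>
        cases l using Fin.cases with
        | zero => exact absurd rfl h2
        | succ l' => exact ⟨l'.succ.succ, by rw [coe_degenOne, degenCoord_succ_succ, hi]⟩
  by_cases hi1 : i = 1
  · by_cases hj2 : j = 2
    · subst hi1; subst hj2
      exact ⟨1, by rw [coe_degenOne, degenCoord_one, hi, hj, add_zero]⟩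
    · by_cases hj1 : j = 1
      · exact absurd (hi1.trans hj1.symm) hij
      · exact key j hj hj1 hj2
  · by_cases hi2 : i = 2
    · by_cases hj1 : j = 1
      · subst hi2; subst hj1
        exact ⟨1, by rw [coe_degenOne, degenCoord_one, hi, hj, add_zero]⟩
      · by_cases hj2 : j = 2
        · exact absurd (hi2.trans hj2.symm) hij
        · exact key j hj hj1 hj2
    · exact key i hi hi1 hi2

/-- The degeneracy maps vertices to vertices (every vertex lies on the facet `δ₁` or `δ₂`).
[folklore] -/
lemma exists_degenOne_vertex (i : Fin (n + 3)) :
    ∃ i' : Fin (n + 2), degenOne n (stdSimplex.vertex (S := ℝ) i) = stdSimplex.vertex (S := ℝ) i' := by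
  by_cases hi : i = 1
  · subst hi
    refine ⟨1, ?_⟩
    have h21 : (2 : Fin (n + 3)).succAbove 1 = 1 := by
      rw [Fin.succAbove_of_castSucc_lt _ _ (by
        rw [Fin.lt_def, Fin.val_castSucc, Fin.val_one, Fin.val_two]; omega), Fin.castSucc_one]
    rw [show stdSimplex.vertex (S := ℝ) (1 : Fin (n + 3)) = stdFace 2 (stdSimplex.vertex (S := ℝ) 1) from by
      rw [stdFace_vertex, h21], degenOne_stdFace_two]
  · obtain ⟨l, hl⟩ := Fin.exists_succAbove_eq hi
    refine ⟨l, ?_⟩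
    rw [← hl, ← stdFace_vertex, degenOne_stdFace_one]

/-- The degeneracy keeps the edge `[v₀, v₁]` inside the edge `[v₀, v₁]`. [folklore] -/
lemma degenOne_edge {z : StdSimplex (n + 2)} (hz : ∀ k : Fin (n + 1), (z : Fin (n + 3) → ℝ) k.succ.succ = 0)
    (k : Fin n) : ((degenOne n z : StdSimplex (n + 1)) : Fin (n + 2) → ℝ) k.succ.succ = 0 := by
  rw [coe_degenOne, degenCoord_succ_succ]; exact hz k.succ

variable {M : ℕ}

/-- **Join classes are inverse cone classes**: for `α : Δ^{M+3} → X` with boundary in `A`, all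
vertices at `a` and the edge `[v₀, v₁]` at `a`, `[α]_j = -[α]_c` in `π_{M+3}(X, A, a)` — the mixed
identity for the degenerate simplex `α ∘ s₁`, whose facets `1`, `2` are `α` and whose other facets
lie in `A`. [folklore] -/
theorem ofMul_joinClass_eq_neg (α : C(StdSimplex (M + 3), X))
    (hb : ∀ t ∈ stdBoundary (M + 3), α t ∈ A)
    (hαv : ∀ i : Fin (M + 4), α (stdSimplex.vertex (S := ℝ) i) = a) (hαe : EdgeToBase a α) :
    Additive.ofMul (joinClass α hb hαe) = -Additive.ofMul (coneClass α ⟨hb, hαv 0⟩) := by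
  -- the degenerate simplex and its hypotheses
  set τ : C(StdSimplex (M + 4), X) := α.comp (degenOne (M + 2)) with hτ
  have hA : ∀ t ∈ stdSkel (M + 4) (M + 2), τ t ∈ A := fun t ht => hb _ (degenOne_mem_stdBoundary ht)
  have hv : ∀ i : Fin (M + 5), τ (stdSimplex.vertex (S := ℝ) i) = a := fun i => by
    obtain ⟨i', hi'⟩ := exists_degenOne_vertex (n := M + 2) i
    rw [hτ, ContinuousMap.comp_apply, hi', hαv]
  have he : EdgeToBase a τ := fun z hz => hαe _ fun k => degenOne_edge hz k
  have key := sum_mixed_eq_zero τ hA hv he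
  rw [sum_cons_cons_neg_eq] at key
  -- facet `0` lies in `A`, facet `1` is `α`
  rw [coneClass_eq_one_of_forall_mem (α := τ.comp (stdFace 0)) _ (fun t =>
      show α (degenOne (M + 2) (stdFace 0 t)) ∈ A from hb _ ⟨0, degenOne_stdFace_zero_apply_zero t⟩),
    ofMul_one, zero_sub, coneClass_congr (α := τ.comp (stdFace 1)) (α' := α) _ ⟨hb, hαv 0⟩ (fun t => by
      show α (degenOne (M + 2) (stdFace 1 t)) = α t; rw [degenOne_stdFace_one])] at key
  -- only the summand `k = 0` (facet `2`, which is `α`) survives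
  rw [Finset.sum_eq_single (0 : Fin (M + 2)) (fun k _ hk => ?_) (fun h => absurd (Finset.mem_univ _) h)]
    at key
  · rw [if_neg (fun h => by have := congrArg Fin.val h; simp at this), sub_zero, Fin.val_zero,
      zero_add, pow_one, neg_smul, one_smul, joinClass_congr (β' := α) _ _ hb hαe (fun t => by
        show α (degenOne (M + 2) (stdFace (Fin.castSucc 0).succ.succ t)) = α t
        rw [show (Fin.castSucc (0 : Fin (M + 2))).succ.succ = (2 : Fin (M + 5)) from rfl,
          degenOne_stdFace_two])] at key
    -- `-c + -j = 0`
    rw [eq_neg_iff_add_eq_zero, ← neg_eq_zero, neg_add_rev]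
    exact key
  · -- the facets `k + 2 ≥ 3` and the last facet lie in `A`
    obtain ⟨l, rfl⟩ := Fin.exists_succ_eq.2 hk
    have hfacet : ∀ t, (τ.comp (stdFace l.succ.castSucc.succ.succ)) t ∈ A := fun t =>
      show α (degenOne (M + 2) (stdFace l.succ.castSucc.succ.succ t)) ∈ A from
        hb _ ⟨l.castSucc.succ.succ, by
          rw [show l.succ.castSucc.succ.succ = l.castSucc.succ.succ.succ from by simp,
            degenOne_stdFace_succ_succ_succ_apply]⟩
    have hlast : ∀ t, (τ.comp (stdFace (Fin.last (M + 2)).succ.succ)) t ∈ A := fun t =>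
      show α (degenOne (M + 2) (stdFace (Fin.last (M + 2)).succ.succ t)) ∈ A from
        hb _ ⟨(Fin.last (M + 1)).succ.succ, by
          rw [show (Fin.last (M + 2)).succ.succ = (Fin.last (M + 1)).succ.succ.succ from by simp [Fin.succ_last],
            degenOne_stdFace_succ_succ_succ_apply]⟩
    rw [joinClass_eq_one_of_forall_mem _ _ hfacet, ofMul_one, zero_sub]
    by_cases hl : l.succ = Fin.last (M + 1)
    · rw [if_pos hl, joinClass_eq_one_of_forall_mem _ _ hlast, ofMul_one, neg_zero, smul_zero]
    · rw [if_neg hl, neg_zero, smul_zero]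

end Degenerate

/-! ### The relative homotopy addition theorem -/

/-- **The relative homotopy addition theorem** (Spanier 1981, Ch. 7 §5, Prop. 3 `Bₙ`, in the
pushed-forward form of part (d), p. 397: "`∑ (-1)ⁱ [σ⁽ⁱ⁾]' = η σ_# j_# (bₙ) = 0`"), for the cone
classes: for every pair `(X, A)`, `a ∈ A`, and every singular simplex `τ : Δ^{M+4} → X` sending the
codimension-two skeleton into `A`, the vertices to `a` and the edge `[v₀, v₁]` to `a`,
`∑ᵢ (-1)ⁱ [τ ∘ δᵢ] = 0` in `π_{M+3}(X, A, a)` (written additively). [cite: Spanier1981, Ch. 7 §5 Prop. 3] -/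
theorem sum_neg_one_pow_smul_coneClass_eq_zero {M : ℕ} (τ : C(StdSimplex (M + 4), X))
    (hA : ∀ t ∈ stdSkel (M + 4) (M + 2), τ t ∈ A)
    (hv : ∀ i : Fin (M + 5), τ (stdSimplex.vertex (S := ℝ) i) = a) (he : EdgeToBase a τ) :
    ∑ i : Fin (M + 5), ((-1 : ℤ) ^ (i : ℕ)) •
      Additive.ofMul (coneClass (τ.comp (stdFace i)) (comp_stdFace_mem_relSimplexMap τ hA hv i)) = 0 := by
  refine Eq.trans (Finset.sum_congr rfl fun i _ => ?_) (sum_mixed_eq_zero τ hA hv he)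
  congr 1
  cases i using Fin.cases with
  | zero => rfl
  | succ j =>
    cases j using Fin.cases with
    | zero => rfl
    | succ k =>
      rw [Fin.cons_succ, Fin.cons_succ, ofMul_joinClass_eq_neg _ _ (facet_vertex τ hv _), neg_neg]

end Literature.AlgebraicTopology.SingularHomology

end
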